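import Summits.CriticalPhenomena.CardyFormulaZ2.Theorems.CardyComplexConeSLESixFamiliesGiveCardySmoothMarkFamiliesPart2
import HarnessLib

/-!
# Smooth-mark discretisation families, part 3: staircase structure of the discrete boundary near a smooth mark

Helper file for stub `stub_smoothMarkFamilies` of line `collar-touch-sandwich` of crux
`SLESixFamiliesGiveCardy` (stmt-CriticalPhenomena-9654).  Standing hypotheses as in part 2 (the
normalised local epigraph picture in a lattice frame).  Contents: `Ω_δ`-adjacency of neighbouring
epigraph sites near the mark, the inner-face criterion `N (j + 1) ≤ m` (both directions), the
staircase bound `row x ≤ N (col x + 1)` and the height bound `0 < δ row - G (δ col) ≤ 2δ` for sites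
of `zdBoundary` near the mark, and the CUT EDGE `{(j₀ - 1, N j₀), (j₀, N j₀)}` of a column `j₀` next
to the mark: an edge of `Ω_δ` between two boundary sites, a side of exactly one inner face, and the
only `Ω_δ`-edge near the mark joining a boundary site of column `< j₀` to one of column `≥ j₀`.
-/

noncomputable section

open Set Metric
open Literature.Probability Literature.Probability.RandomPlanarGeometry
  Literature.Probability.LatticeModels Literature.Probability.Percolation

namespace Summit.CriticalPhenomena.CardyFormulaZ2.Cruxes.SLESixFamiliesGiveCardy.CollarTouchSandwich

namespace SmoothMark

section Local

variable {E : DiscreteDobrushin} {k : Fin 2} {s t : ℤ} {U V : ℂ} {G : ℝ → ℝ} {α R : ℝ} {p : ℂ}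
  {N : ℤ → ℤ}
  (hs : s = 1 ∨ s = -1) (ht : t = 1 ∨ t = -1)
  (hU : U = Site.toComplex (Pi.single k s)) (hV : V = Site.toComplex (Pi.single k.rev t))
  (hp : p = (α : ℂ) * U + ((G α : ℝ) : ℂ) * V)
  (hδ : 0 < E.δ) (hδR : 32 * E.δ ≤ R) (hmono : Monotone G) (hlip : ∀ a b, |G a - G b| ≤ |a - b|)
  (hepi : ∀ a b : ℝ, dist ((a : ℂ) * U + (b : ℂ) * V) p < R → ((a : ℂ) * U + (b : ℂ) * V ∈ E.Ω ↔ G a < b))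
  (hbulk : ∀ x : Site 2, |E.δ * (s * x k) - α| ≤ R / 4 → 3 * R / 8 ≤ E.δ * (t * x k.rev) - G α →
    E.δ * (t * x k.rev) - G α ≤ R / 2 → x ∈ meshDomain E.Ω E.δ)
  (hN : ∀ j : ℤ, N j = ⌊G (E.δ * j) / E.δ⌋ + 1)

include hs ht hU hV hp hδ hδR hmono hepi hbulk hN in
/-- **`Ω_δ`-adjacency of neighbouring epigraph sites near the mark.** Two `ℤ²`-neighbours of the
window `B(p, R/4)` which are epigraph sites are joined in `Ω_δ`: both are in `meshDomain`, and the
closed mesh edge stays in `Ω` (vertical edges trivially, horizontal ones by monotonicity of `G`).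
[folklore] -/
theorem adj_of_N_le {x y : Site 2} (hxy : (zdGraph 2).Adj x y)
    (hx : dist (meshPoint E.δ x) p < R / 4) (hy : dist (meshPoint E.δ y) p < R / 4)
    (hNx : N (s * x k) ≤ t * x k.rev) (hNy : N (s * y k) ≤ t * y k.rev) :
    (discreteDomainGraph E.Ω E.δ).Adj x y := by
  refine discreteDomainGraph_adj_iff.2 ⟨meshGraph_adj_iff.2 ⟨hxy, ?_⟩,
    mem_meshDomain_of_N_le hs ht hU hV hp hδ hδR hepi hbulk hN hx hNx,
    mem_meshDomain_of_N_le hs ht hU hV hp hδ hδR hepi hbulk hN hy hNy⟩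
  have hGx : G (E.δ * (s * x k)) < E.δ * (t * x k.rev) := by
    have := (N_le_iff hδ hN _ _).1 hNx; push_cast at this; exact this
  have hGy : G (E.δ * (s * y k)) < E.δ * (t * y k.rev) := by
    have := (N_le_iff hδ hN _ _).1 hNy; push_cast at this; exact this
  have hxB : meshPoint E.δ x ∈ ball p R := mem_ball.2 (by linarith)
  have hyB : meshPoint E.δ y ∈ ball p R := mem_ball.2 (by linarith)
  rw [meshPoint_eq_frame hs ht hU hV] at hxB
  rw [meshPoint_eq_frame hs ht hU hV] at hyB
  rw [meshPoint_eq_frame hs ht hU hV (x := x), meshPoint_eq_frame hs ht hU hV (x := y)]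
  rcases (frame_adj_iff k hs ht).1 hxy with ⟨hc, hr⟩ | ⟨hr, hc⟩
  · -- horizontal edge
    have hrR : (t : ℝ) * y k.rev = t * x k.rev := by exact_mod_cast hr
    rw [hrR]
    refine (segment_horiz_subset (convex_ball p R) hxB (by rw [← hrR]; exact hyB)
      fun a' ha1 ha2 hB => ?_).trans subset_closure
    refine (hepi _ _ (mem_ball.1 hB)).2 ?_
    rcases hc with hc | hc
    · have hcR : (s : ℝ) * y k = s * x k + 1 := by exact_mod_cast hc
      calc G a' ≤ G (E.δ * (s * y k)) := hmono (by
            refine ha2.trans ?_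
            rw [max_le_iff, hcR]; constructor <;> nlinarith)
        _ < E.δ * (t * x k.rev) := by rw [← hrR]; exact hGy
    · have hcR : (s : ℝ) * x k = s * y k + 1 := by exact_mod_cast hc.symm
      calc G a' ≤ G (E.δ * (s * x k)) := hmono (by
            refine ha2.trans ?_
            rw [max_le_iff, hcR]; constructor <;> nlinarith)
        _ < E.δ * (t * x k.rev) := hGx
  · -- vertical edge
    have hcR : (s : ℝ) * y k = s * x k := by exact_mod_cast hc
    rw [hcR]
    refine (segment_vert_subset (convex_ball p R) hxB (by rw [← hcR]; exact hyB)
      fun b' hb1 hb2 hB => ?_).trans subset_closure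
    refine (hepi _ _ (mem_ball.1 hB)).2 (lt_of_lt_of_le ?_ hb1)
    rw [hcR] at hGy
    exact lt_min hGx hGy

include hs ht hU hV hp hδ hδR hmono hepi hbulk hN in
/-- **Inner-face criterion (sufficiency).** A face all of whose corners lie in the window
`B(p, R/4)` and whose frame coordinates `(j, m)` satisfy `N (j + 1) ≤ m` is inner. [folklore] -/
theorem isInnerFace_of_N_le {f : Site 2}
    (hf : ∀ w, LatticeModels.IsCorner w f → dist (meshPoint E.δ w) p < R / 4)
    (hNf : N (s * f k + (s - 1) / 2 + 1) ≤ t * f k.rev + (t - 1) / 2) : E.IsInnerFace f := by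
  intro v w hv hw hvw
  have hmN := N_monotone hδ hN hmono
  have key : ∀ u, LatticeModels.IsCorner u f → N (s * u k) ≤ t * u k.rev := by
    intro u hu
    obtain ⟨hc, hr⟩ := (frame_isCorner_iff k hs ht).1 hu
    calc N (s * u k) ≤ N (s * f k + (s - 1) / 2 + 1) := hmN (by omega)
      _ ≤ t * f k.rev + (t - 1) / 2 := hNf
      _ ≤ t * u k.rev := by omega
  exact adj_of_N_le hs ht hU hV hp hδ hδR hmono hepi hbulk hN hvw (hf v hv) (hf w hw) (key v hv) (key w hw)

include hs ht hU hV hδ hepi hN in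
/-- **Inner-face criterion (necessity).** An inner face whose corners lie in `B(p, R)` has frame
coordinates `(j, m)` with `N (j + 1) ≤ m` (its corner `(j + 1, m)` is a site of `Ω_δ`). [folklore] -/
theorem N_le_of_isInnerFace {f : Site 2}
    (hf : ∀ w, LatticeModels.IsCorner w f → dist (meshPoint E.δ w) p < R) (hin : E.IsInnerFace f) :
    N (s * f k + (s - 1) / 2 + 1) ≤ t * f k.rev + (t - 1) / 2 := by
  set j : ℤ := s * f k + (s - 1) / 2 with hj
  set m : ℤ := t * f k.rev + (t - 1) / 2 with hm
  set w₁ : Site 2 := Pi.single k (s * (j + 1)) + Pi.single k.rev (t * m) with hw₁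
  set w₂ : Site 2 := Pi.single k (s * (j + 1)) + Pi.single k.rev (t * (m + 1)) with hw₂
  have c1 : s * w₁ k = j + 1 := col_frameSite k hs ht (j + 1) m
  have r1 : t * w₁ k.rev = m := row_frameSite k hs ht (j + 1) m
  have c2 : s * w₂ k = j + 1 := col_frameSite k hs ht (j + 1) (m + 1)
  have r2 : t * w₂ k.rev = m + 1 := row_frameSite k hs ht (j + 1) (m + 1)
  have h1 : LatticeModels.IsCorner w₁ f := (frame_isCorner_iff k hs ht).2 ⟨by omega, by omega⟩
  have h2 : LatticeModels.IsCorner w₂ f := (frame_isCorner_iff k hs ht).2 ⟨by omega, by omega⟩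
  have hadj : (zdGraph 2).Adj w₁ w₂ := (frame_adj_iff k hs ht).2 (Or.inr ⟨by omega, by omega⟩)
  have hD := (discreteDomainGraph_adj_iff.1 (hin w₁ w₂ h1 h2 hadj)).2.1
  have hV1 := (mem_meshVertices_iff_N_le hs ht hU hV hδ hepi hN (hf w₁ h1)).1
    (meshDomain_subset_meshVertices _ _ hD)
  rwa [c1, r1] at hV1

include hs ht hU hV hp hδ hδR hmono hepi hbulk hN in
/-- **Boundary sites near the mark lie on the staircase.** A site of `zdBoundary` whose mesh point
is within `R/4 - 2δ` of the mark satisfies `row x ≤ N (col x + 1)`: otherwise its four neighbours are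
`Ω_δ`-adjacent to it and its four faces are inner, so it is neither in `meshBoundary` nor an
endpoint of a face-boundary edge. [folklore] -/
theorem row_le_N_of_mem_zdBoundary {x : Site 2} (hx : x ∈ E.zdBoundary)
    (hxp : dist (meshPoint E.δ x) p < R / 4 - 2 * E.δ) : t * x k.rev ≤ N (s * x k + 1) := by
  by_contra hlt
  push Not at hlt
  have hmN := N_monotone hδ hN hmono
  have hNx : N (s * x k) ≤ t * x k.rev := (hmN (by omega)).trans hlt.le
  have hnear : ∀ y : Site 2, |s * y k - s * x k| ≤ 1 → |t * y k.rev - t * x k.rev| ≤ 1 →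
      dist (meshPoint E.δ y) p < R / 4 := fun y h1 h2 =>
    calc dist (meshPoint E.δ y) p ≤ dist (meshPoint E.δ y) (meshPoint E.δ x) + dist (meshPoint E.δ x) p :=
          dist_triangle _ _ _
      _ < 2 * E.δ + (R / 4 - 2 * E.δ) :=
          add_lt_add_of_le_of_lt (dist_meshPoint_le_frame hs ht hU hV hδ.le h1 h2) hxp
      _ = R / 4 := by ring
  have hxR : dist (meshPoint E.δ x) p < R / 4 := by
    have := hnear x (by simp) (by simp); exact this
  -- every lattice neighbour is `Ω_δ`-adjacent
  have hnb : ∀ y, (zdGraph 2).Adj x y → (discreteDomainGraph E.Ω E.δ).Adj x y := by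
    intro y hy
    rcases (frame_adj_iff k hs ht).1 hy with ⟨hc, hr⟩ | ⟨hr, hc⟩
    · refine adj_of_N_le hs ht hU hV hp hδ hδR hmono hepi hbulk hN hy hxR
        (hnear y (by rw [abs_le]; omega) (by rw [abs_le]; omega)) hNx ?_
      rw [hr]
      rcases hc with hc | hc
      · rw [hc]; exact hlt.le
      · exact (hmN (show s * y k ≤ s * x k by omega)).trans hNx
    · refine adj_of_N_le hs ht hU hV hp hδ hδR hmono hepi hbulk hN hy hxR
        (hnear y (by rw [abs_le]; omega) (by rw [abs_le]; omega)) hNx ?_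
      rw [hc]
      have := hmN (show s * x k ≤ s * x k + 1 by omega)
      omega
  -- every face at `x` is inner
  have hfaces : ∀ f, LatticeModels.IsCorner x f → E.IsInnerFace f := by
    intro f hxf
    obtain ⟨hc, hr⟩ := (frame_isCorner_iff k hs ht).1 hxf
    refine isInnerFace_of_N_le hs ht hU hV hp hδ hδR hmono hepi hbulk hN (fun w hw => ?_) ?_
    · obtain ⟨hcw, hrw⟩ := (frame_isCorner_iff k hs ht).1 hw
      exact hnear w (by rw [abs_le]; omega) (by rw [abs_le]; omega)
    · have := hmN (show s * f k + (s - 1) / 2 + 1 ≤ s * x k + 1 by omega)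
      omega
  rcases hx with ⟨-, y, hy, hny⟩ | ⟨y, -, -, f, hf, hxf, -⟩
  · exact hny (hnb y hy)
  · exact hf (hfaces f hxf)

include hs ht hU hV hp hδ hδR hmono hlip hepi hbulk hN in
/-- **Heights on the staircase.** A boundary site near the mark lies above the graph by at most
`2δ`: `0 < δ row x - G (δ col x) ≤ 2δ`. [folklore] -/
theorem height_of_mem_zdBoundary {x : Site 2} (hx : x ∈ E.zdBoundary) (hxp : dist (meshPoint E.δ x) p < R / 4 - 2 * E.δ) :
    0 < E.δ * (t * x k.rev) - G (E.δ * (s * x k)) ∧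
      E.δ * (t * x k.rev) - G (E.δ * (s * x k)) ≤ 2 * E.δ := by
  have hxR : dist (meshPoint E.δ x) p < R := by linarith [hδ.le]
  have hV1 := (mem_meshVertices_iff_N_le hs ht hU hV hδ hepi hN hxR).1
    (meshDomain_subset_meshVertices _ _ (E.zdBoundary_subset_meshDomain hx))
  have h1 : G (E.δ * (s * x k)) < E.δ * (t * x k.rev) := by
    have := (N_le_iff hδ hN _ _).1 hV1; push_cast at this; exact this
  have h2 := row_le_N_of_mem_zdBoundary hs ht hU hV hp hδ hδR hmono hepi hbulk hN hx hxp
  have h3 := (G_lt_and_le hδ hN (s * x k + 1)).2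
  have h4 : E.δ * (t * x k.rev : ℝ) ≤ E.δ * (N (s * x k + 1) : ℝ) :=
    mul_le_mul_of_nonneg_left (by exact_mod_cast h2) hδ.le
  have h5 := hlip (E.δ * (s * x k + 1 : ℤ)) (E.δ * (s * x k))
  push_cast at h3 h4 h5
  rw [show E.δ * (s * x k + 1) - E.δ * (s * x k) = E.δ by ring, abs_of_pos hδ] at h5
  refine ⟨by linarith, ?_⟩
  linarith [(abs_le.1 h5).2]

include hs ht hU hV hp hδ hδR hmono hepi hbulk hN in
/-- **Rows increase along the staircase**: for boundary sites near the mark, a strictly larger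
frame column forces a weakly larger frame row. [folklore] -/
theorem row_le_row_of_col_lt {x y : Site 2} (hx : x ∈ E.zdBoundary) (hy : y ∈ E.zdBoundary)
    (hxp : dist (meshPoint E.δ x) p < R / 4 - 2 * E.δ) (hyp : dist (meshPoint E.δ y) p < R / 4 - 2 * E.δ)
    (hlt : s * x k < s * y k) : t * x k.rev ≤ t * y k.rev := by
  have hyR : dist (meshPoint E.δ y) p < R := by linarith [hδ.le]
  have hV1 := (mem_meshVertices_iff_N_le hs ht hU hV hδ hepi hN hyR).1
    (meshDomain_subset_meshVertices _ _ (E.zdBoundary_subset_meshDomain hy))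
  exact (row_le_N_of_mem_zdBoundary hs ht hU hV hp hδ hδR hmono hepi hbulk hN hx hxp).trans
    ((N_monotone hδ hN hmono (by omega)).trans hV1)

/-! ### The cut edge next to the mark -/

section Cut

variable (j₀ : ℤ) (hj₀ : |E.δ * j₀ - α| ≤ E.δ)

include hs ht hU hV hp hδ hlip hN hj₀ in
/-- Sites whose frame coordinates are within one of `(j₀, N j₀)` are within `5δ` of the mark.
[folklore] -/
theorem dist_le_of_near_cut {w : Site 2} (h1 : |s * w k - j₀| ≤ 1) (h2 : |t * w k.rev - N j₀| ≤ 1) :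
    dist (meshPoint E.δ w) p ≤ 5 * E.δ := by
  rw [meshPoint_eq_frame hs ht hU hV, hp]
  refine (dist_le_abs_add_abs_frame hs ht hU hV _ _ _ _).trans ?_
  have h1' : |((s * w k : ℤ) : ℝ) - j₀| ≤ 1 := by
    rw [← Int.cast_sub, ← Int.cast_abs]; exact_mod_cast h1
  have h2' : |((t * w k.rev : ℤ) : ℝ) - N j₀| ≤ 1 := by
    rw [← Int.cast_sub, ← Int.cast_abs]; exact_mod_cast h2
  push_cast at h1' h2'
  obtain ⟨hG1, hG2⟩ := G_lt_and_le hδ hN j₀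
  have hG3 := hlip (E.δ * j₀) α
  have e1 : |E.δ * (s * w k) - α| ≤ 2 * E.δ := by
    calc |E.δ * (s * w k) - α| = |E.δ * (s * w k - j₀) + (E.δ * j₀ - α)| := by ring_nf
      _ ≤ |E.δ * (s * w k - j₀)| + |E.δ * j₀ - α| := abs_add_le _ _
      _ ≤ E.δ * 1 + E.δ := by
          rw [abs_mul, abs_of_pos hδ]
          exact add_le_add (mul_le_mul_of_nonneg_left h1' hδ.le) hj₀
      _ = 2 * E.δ := by ring
  have e2 : |E.δ * (t * w k.rev) - G α| ≤ 3 * E.δ := by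
    calc |E.δ * (t * w k.rev) - G α|
        = |E.δ * (t * w k.rev - N j₀) + (E.δ * N j₀ - G (E.δ * j₀)) + (G (E.δ * j₀) - G α)| := by ring_nf
      _ ≤ |E.δ * (t * w k.rev - N j₀)| + |E.δ * N j₀ - G (E.δ * j₀)| + |G (E.δ * j₀) - G α| :=
          abs_add_three _ _ _
      _ ≤ E.δ * 1 + E.δ + E.δ := by
          refine add_le_add (add_le_add ?_ ?_) (hG3.trans hj₀)
          · rw [abs_mul, abs_of_pos hδ]; exact mul_le_mul_of_nonneg_left h2' hδ.le
          · rw [abs_le]; constructor <;> linarith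
      _ = 3 * E.δ := by ring
  linarith

include hs ht hU hV hp hδ hδR hmono hlip hepi hbulk hN hj₀ in
/-- **The cut edge is an edge of `Ω_δ`.** [folklore] -/
theorem cut_adj : (discreteDomainGraph E.Ω E.δ).Adj
    (Pi.single k (s * (j₀ - 1)) + Pi.single k.rev (t * N j₀))
    (Pi.single k (s * j₀) + Pi.single k.rev (t * N j₀)) := by
  have c0 := col_frameSite k hs ht (j₀ - 1) (N j₀)
  have r0 := row_frameSite k hs ht (j₀ - 1) (N j₀)
  have c1 := col_frameSite k hs ht j₀ (N j₀)
  have r1 := row_frameSite k hs ht j₀ (N j₀)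
  have hR4 : 5 * E.δ < R / 4 := by linarith
  refine adj_of_N_le hs ht hU hV hp hδ hδR hmono hepi hbulk hN
    ((frame_adj_iff k hs ht).2 (Or.inl ⟨by omega, by omega⟩)) ?_ ?_ ?_ ?_
  · exact (dist_le_of_near_cut hs ht hU hV hp hδ hlip hN j₀ hj₀ (by rw [c0]; simp) (by rw [r0]; simp)).trans_lt hR4
  · exact (dist_le_of_near_cut hs ht hU hV hp hδ hlip hN j₀ hj₀ (by rw [c1]; simp) (by rw [r1]; simp)).trans_lt hR4
  · rw [c0, r0]; exact N_monotone hδ hN hmono (by omega)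
  · rw [c1, r1]

include hs ht hU hV hp hδ hδR hmono hlip hepi hbulk hN hj₀ in
/-- **The two faces of the cut edge**: the face above it (frame coordinates `(j₀ - 1, N j₀)`) is
inner, the face below it (`(j₀ - 1, N j₀ - 1)`) is not; hence the cut edge is a face-boundary edge,
its endpoints are boundary sites, and it is a side of exactly one inner face. [folklore] -/
theorem cut_faces :
    E.IsFaceBoundaryEdge (Pi.single k (s * (j₀ - 1)) + Pi.single k.rev (t * N j₀))
        (Pi.single k (s * j₀) + Pi.single k.rev (t * N j₀)) ∧
      ∃! f, E.IsInnerFace f ∧ ∀ x ∈ s(Pi.single k (s * (j₀ - 1)) + Pi.single k.rev (t * N j₀),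
        (Pi.single k (s * j₀) + Pi.single k.rev (t * N j₀) : Site 2)), LatticeModels.IsCorner x f := by
  have c0 := col_frameSite k hs ht (j₀ - 1) (N j₀)
  have r0 := row_frameSite k hs ht (j₀ - 1) (N j₀)
  have c1 := col_frameSite k hs ht j₀ (N j₀)
  have r1 := row_frameSite k hs ht j₀ (N j₀)
  have hR4 : 5 * E.δ < R / 4 := by linarith
  have hR1 : 5 * E.δ < R := by linarith
  have hnear : ∀ w : Site 2, |s * w k - j₀| ≤ 1 → |t * w k.rev - N j₀| ≤ 1 →
      dist (meshPoint E.δ w) p ≤ 5 * E.δ := fun w => dist_le_of_near_cut hs ht hU hV hp hδ hlip hN j₀ hj₀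
  obtain ⟨fu, hfu1, hfu2⟩ := exists_face_frame k hs ht (j₀ - 1) (N j₀)
  obtain ⟨fd, hfd1, hfd2⟩ := exists_face_frame k hs ht (j₀ - 1) (N j₀ - 1)
  -- corners of the two faces are near the mark
  have hcu : ∀ w, LatticeModels.IsCorner w fu → dist (meshPoint E.δ w) p < R / 4 := by
    intro w hw
    obtain ⟨hc, hr⟩ := (frame_isCorner_iff k hs ht).1 hw
    exact (hnear w (by rw [abs_le]; omega) (by rw [abs_le]; omega)).trans_lt hR4
  have hcd : ∀ w, LatticeModels.IsCorner w fd → dist (meshPoint E.δ w) p < R := by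
    intro w hw
    obtain ⟨hc, hr⟩ := (frame_isCorner_iff k hs ht).1 hw
    exact (hnear w (by rw [abs_le]; omega) (by rw [abs_le]; omega)).trans_lt hR1
  have hu : E.IsInnerFace fu :=
    isInnerFace_of_N_le hs ht hU hV hp hδ hδR hmono hepi hbulk hN hcu (by rw [hfu1, hfu2]; simp)
  have hd : ¬ E.IsInnerFace fd := fun h => by
    have := N_le_of_isInnerFace hs ht hU hV hδ hepi hN hcd h
    rw [hfd1, hfd2] at this
    simp at this
  -- the endpoints are corners of both faces
  have hz0u : LatticeModels.IsCorner (Pi.single k (s * (j₀ - 1)) + Pi.single k.rev (t * N j₀)) fu :=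
    (frame_isCorner_iff k hs ht).2 ⟨by omega, by omega⟩
  have hz1u : LatticeModels.IsCorner (Pi.single k (s * j₀) + Pi.single k.rev (t * N j₀)) fu :=
    (frame_isCorner_iff k hs ht).2 ⟨by omega, by omega⟩
  have hz0d : LatticeModels.IsCorner (Pi.single k (s * (j₀ - 1)) + Pi.single k.rev (t * N j₀)) fd :=
    (frame_isCorner_iff k hs ht).2 ⟨by omega, by omega⟩
  have hz1d : LatticeModels.IsCorner (Pi.single k (s * j₀) + Pi.single k.rev (t * N j₀)) fd :=
    (frame_isCorner_iff k hs ht).2 ⟨by omega, by omega⟩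
  have hadj := cut_adj hs ht hU hV hp hδ hδR hmono hlip hepi hbulk hN j₀ hj₀
  refine ⟨⟨hadj, ⟨fu, hu, hz0u, hz1u⟩, ⟨fd, hd, hz0d, hz1d⟩⟩, fu, ⟨hu, ?_⟩, ?_⟩
  · intro x hx
    rcases Sym2.mem_iff.1 hx with rfl | rfl
    exacts [hz0u, hz1u]
  · rintro f' ⟨hf', hcf'⟩
    have h0 := (frame_isCorner_iff k hs ht).1 (hcf' _ (Sym2.mem_mk_left _ _))
    have h1 := (frame_isCorner_iff k hs ht).1 (hcf' _ (Sym2.mem_mk_right _ _))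
    rw [c0, r0] at h0
    rw [c1, r1] at h1
    have hj : s * f' k + (s - 1) / 2 = j₀ - 1 := by omega
    by_cases hm : t * f' k.rev + (t - 1) / 2 = N j₀
    · exact eq_of_frame_eq k hs ht (by omega) (by omega)
    · exfalso
      have hm' : t * f' k.rev + (t - 1) / 2 = N j₀ - 1 := by omega
      have hcf : ∀ w, LatticeModels.IsCorner w f' → dist (meshPoint E.δ w) p < R := by
        intro w hw
        obtain ⟨hc, hr⟩ := (frame_isCorner_iff k hs ht).1 hw
        exact (hnear w (by rw [abs_le]; omega) (by rw [abs_le]; omega)).trans_lt hR1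
      have := N_le_of_isInnerFace hs ht hU hV hδ hepi hN hcf hf'
      rw [hj, hm'] at this
      simp at this

include hs ht hU hV hp hδ hδR hmono hepi hbulk hN in
/-- **Uniqueness of the cut edge near the mark.** An edge of `Ω_δ` between two boundary sites near
the mark, one of frame column `< j₀` and one of frame column `≥ j₀`, is the cut edge. [folklore] -/
theorem eq_cut_of_adj {x y : Site 2} (hxy : (discreteDomainGraph E.Ω E.δ).Adj x y)
    (hx : x ∈ E.zdBoundary) (hxp : dist (meshPoint E.δ x) p < R / 4 - 2 * E.δ)
    (hcx : s * x k < j₀) (hcy : j₀ ≤ s * y k) :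
    x = Pi.single k (s * (j₀ - 1)) + Pi.single k.rev (t * N j₀) ∧
      y = Pi.single k (s * j₀) + Pi.single k.rev (t * N j₀) := by
  obtain ⟨hm, -, hyD⟩ := discreteDomainGraph_adj_iff.1 hxy
  have hzd := (meshGraph_adj_iff.1 hm).1
  rcases (frame_adj_iff k hs ht).1 hzd with ⟨hc | hc, hr⟩ | ⟨-, hc⟩
  · have hcx' : s * x k = j₀ - 1 := by omega
    have hcy' : s * y k = j₀ := by omega
    have h1 := row_le_N_of_mem_zdBoundary hs ht hU hV hp hδ hδR hmono hepi hbulk hN hx hxp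
    rw [hcx', sub_add_cancel] at h1
    have hyp : dist (meshPoint E.δ y) p < R :=
      calc dist (meshPoint E.δ y) p ≤ dist (meshPoint E.δ y) (meshPoint E.δ x) + dist (meshPoint E.δ x) p :=
            dist_triangle _ _ _
        _ < 2 * E.δ + (R / 4 - 2 * E.δ) := add_lt_add_of_le_of_lt
            (dist_meshPoint_le_frame hs ht hU hV hδ.le (by rw [abs_le]; omega) (by rw [abs_le]; omega)) hxp
        _ ≤ R := by linarith [hδ.le]
    have h2 := (mem_meshVertices_iff_N_le hs ht hU hV hδ hepi hN hyp).1
      (meshDomain_subset_meshVertices _ _ hyD)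
    rw [hcy'] at h2
    have hrow : t * x k.rev = N j₀ := by omega
    have c0 := col_frameSite k hs ht (j₀ - 1) (N j₀)
    have r0 := row_frameSite k hs ht (j₀ - 1) (N j₀)
    have c1 := col_frameSite k hs ht j₀ (N j₀)
    have r1 := row_frameSite k hs ht j₀ (N j₀)
    exact ⟨eq_of_frame_eq k hs ht (by omega) (by omega), eq_of_frame_eq k hs ht (by omega) (by omega)⟩
  · omega
  · omega

end Cut

end Local

end SmoothMark

/-! ### Registered sub-goal (one-line signature, verbatim) -/

/-- **Registered sub-goal `smoothMark_part3` of `stub_smoothMarkFamilies`**: boundary sites near a smooth mark lie on the staircase (`row ≤ N (col + 1)`). [folklore] -/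
theorem smoothMark_part3 : ∀ (E : DiscreteDobrushin) (k : Fin 2) (s t : ℤ) (U V : ℂ) (G : ℝ → ℝ) (α R : ℝ) (p : ℂ) (N : ℤ → ℤ), (s = 1 ∨ s = -1) → (t = 1 ∨ t = -1) → U = Site.toComplex (Pi.single k s) → V = Site.toComplex (Pi.single k.rev t) → p = (α : ℂ) * U + ((G α : ℝ) : ℂ) * V → 0 < E.δ → 32 * E.δ ≤ R → Monotone G → (∀ a b : ℝ, dist ((a : ℂ) * U + (b : ℂ) * V) p < R → ((a : ℂ) * U + (b : ℂ) * V ∈ E.Ω ↔ G a < b)) → (∀ x : Site 2, |E.δ * (s * x k) - α| ≤ R / 4 → 3 * R / 8 ≤ E.δ * (t * x k.rev) - G α → E.δ * (t * x k.rev) - G α ≤ R / 2 → x ∈ meshDomain E.Ω E.δ) → (∀ j : ℤ, N j = ⌊G (E.δ * j) / E.δ⌋ + 1) → ∀ x : Site 2, x ∈ E.zdBoundary → dist (meshPoint E.δ x) p < R / 4 - 2 * E.δ → t * x k.rev ≤ N (s * x k + 1) :=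
  fun _ _ _ _ _ _ _ _ _ _ _ hs ht hU hV hp hδ hδR hmono hepi hbulk hN _ hx hxp =>
    SmoothMark.row_le_N_of_mem_zdBoundary hs ht hU hV hp hδ hδR hmono hepi hbulk hN hx hxp

end Summit.CriticalPhenomena.CardyFormulaZ2.Cruxes.SLESixFamiliesGiveCardy.CollarTouchSandwich

end
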